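import Summits.QuantumFields.BalabanUV.Beta.GAN24.LaplaceInverseStaircase
import Summits.QuantumFields.BalabanUV.Beta.GAN24.HardMinimiserOneStepSup

/-!
# G-an2-4 ∕ (CONV-C), road P2, route R2-S1 — THE UNIT-LATTICE BLOCK FORM OF `Δ⁻²`: the one-step difference of
# `E_n = Q′·Δ⁻¹·Δ⁻¹·Q′*` (the operator inverted in Bałaban's `(Q′Δ⁻²Q′*)⁻¹` of (1.26)∕(1.70)∕(1.81), lit-balaban's `B5Hk160Torus.Einv`)
# against the unit torus, EXACTLY, from the massless brick `LaplaceInverseStaircase.LapSinv_succ_sub_stair`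

Unit `b2b-balaban-gan24-p2` (gen 29), BINDER row G-an2-4 ∕ (CONV-C), road P2.  With `D g := Δ′⁻¹(Jg) − J(Δ⁻¹g)` (the massless two-level
defect, `= −Δ′⁻¹(Δ′J − JΔ)Δ⁻¹g` exactly), `Q′_{RN}J = Q′_N` (`HardMinimiserOneStepSup.QsOp_mul_stair`) and `J·Q′*_N = Q′*_{RN}`
(`SoftMinimiserOneStepSup.stair_mulVec_blkInj`):
 * **`LapSinv2_succ_sub_stair`** — `Δ′⁻²(Jf) − J(Δ⁻²f) = Δ′⁻¹(Df) + D(Δ⁻¹f)`;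
 * **`blockBiLapInv_succ_sub`** — `E_{RN}t − E_Nt = Q′_{RN}·(Δ′⁻¹(Df) + D(Δ⁻¹f))`, `f = Q′*_Nt`: the unit-lattice one-step difference of the
   block form of `Δ⁻²` is the block mean of massless two-level defects — the input of `inv_sub_inv` for `(Q′Δ⁻²Q′*)⁻¹`.
HONEST SCOPE.  Exact finite-lattice algebra, every `d`, `N, R ≥ 1`, every torus; [folklore], kernel-checked, no `sorry`, no `def` (the block form is
written out, not named); a BRICK for the `∂P∂*` term and `G182`, no estimate; nothing of Bałaban's asserted ([Balaban1984PropagatorsI] (1.26) p. 22,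
(1.81) p. 31 are TEXT LOCATIONS).  NOT (CONV-C), NEVER «G-an2-4 closed», NOT NE2, NOT D1, NOT BetaPertH, NOT continuum, NOT Clay; not in print —
our bookkeeping.  HONEST DEPENDENCY: continuum YM on T⁴ ⇐ BetaPertH ∧ nine spine estimates (0/9 proved); BetaPertH ⇐ (D1) ∧ (D4) ∧ CAP+tail;
G-an2-4 gates asym, D1 and NE2/3/4.
-/

noncomputable section

open scoped BigOperators ComplexConjugate Matrix

namespace Summit.QuantumFields.BalabanUV.Beta.GAN24.BiharmonicBlockFormStaircase

open Literature.MathematicalPhysics.QuantumFieldTheory.Balaban1983to89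
open B5Prop11Plancherel (Tor fine)
open B5Action121 (LapS)
open B5Block118 (QsOp)
open B5LaplaceInverse (LapSinv)
open Summit.QuantumFields.BalabanUV.Beta.GAN24.StaircaseLaplacianDefect (stair)
open Summit.QuantumFields.BalabanUV.Beta.GAN24.SoftMinimiserOneStepSup (blkInj stair_mulVec_blkInj)
open Summit.QuantumFields.BalabanUV.Beta.GAN24.HardMinimiserOneStepSup (QsOp_mul_stair)
open Summit.QuantumFields.BalabanUV.Beta.GAN24.LaplaceInverseStaircase (LapSinv_succ_sub_stair)

variable {d : ℕ} (N R : ℕ) [NeZero N] [NeZero R] (M : Fin d → ℕ) [hM : ∀ μ, NeZero (M μ)]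

/-- **`Δ′⁻²(Jf) − J(Δ⁻²f) = Δ′⁻¹(Df) + D(Δ⁻¹f)`** with `Dg = Δ′⁻¹(Jg) − J(Δ⁻¹g)` (telescoping of the two-level defect through a product).
[folklore] -/
theorem LapSinv2_succ_sub_stair (f : Tor (fine N M) → ℂ) :
    LapSinv (fine (R * N) M) ((R * N : ℕ) : ℂ) *ᵥ (LapSinv (fine (R * N) M) ((R * N : ℕ) : ℂ) *ᵥ (stair N R M *ᵥ f))
        - stair N R M *ᵥ (LapSinv (fine N M) ((N : ℕ) : ℂ) *ᵥ (LapSinv (fine N M) ((N : ℕ) : ℂ) *ᵥ f))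
      = LapSinv (fine (R * N) M) ((R * N : ℕ) : ℂ) *ᵥ
            (LapSinv (fine (R * N) M) ((R * N : ℕ) : ℂ) *ᵥ (stair N R M *ᵥ f)
              - stair N R M *ᵥ (LapSinv (fine N M) ((N : ℕ) : ℂ) *ᵥ f))
          + (LapSinv (fine (R * N) M) ((R * N : ℕ) : ℂ) *ᵥ (stair N R M *ᵥ (LapSinv (fine N M) ((N : ℕ) : ℂ) *ᵥ f))
              - stair N R M *ᵥ (LapSinv (fine N M) ((N : ℕ) : ℂ) *ᵥ (LapSinv (fine N M) ((N : ℕ) : ℂ) *ᵥ f))) := by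
  rw [Matrix.mulVec_sub]
  abel

/-- **THE ONE-STEP DIFFERENCE OF THE BLOCK FORM OF `Δ⁻²`**: with `f = Q′*_N t` (so `Q′*_{RN}t = Jf`),
`Q′_{RN}Δ′⁻²Q′*_{RN}t − Q′_NΔ⁻²Q′*_Nt = Q′_{RN}·(Δ′⁻¹(Df) + D(Δ⁻¹f))` — the block mean of massless two-level defects. [folklore] -/
theorem blockBiLapInv_succ_sub (t : Tor M → ℂ) :
    QsOp (R * N) M *ᵥ (LapSinv (fine (R * N) M) ((R * N : ℕ) : ℂ) *ᵥ (LapSinv (fine (R * N) M) ((R * N : ℕ) : ℂ) *ᵥ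
        (blkInj (R * N) M *ᵥ t)))
      - QsOp N M *ᵥ (LapSinv (fine N M) ((N : ℕ) : ℂ) *ᵥ (LapSinv (fine N M) ((N : ℕ) : ℂ) *ᵥ (blkInj N M *ᵥ t)))
      = QsOp (R * N) M *ᵥ
          (LapSinv (fine (R * N) M) ((R * N : ℕ) : ℂ) *ᵥ
              (LapSinv (fine (R * N) M) ((R * N : ℕ) : ℂ) *ᵥ (stair N R M *ᵥ (blkInj N M *ᵥ t))
                - stair N R M *ᵥ (LapSinv (fine N M) ((N : ℕ) : ℂ) *ᵥ (blkInj N M *ᵥ t)))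
            + (LapSinv (fine (R * N) M) ((R * N : ℕ) : ℂ) *ᵥ (stair N R M *ᵥ (LapSinv (fine N M) ((N : ℕ) : ℂ) *ᵥ (blkInj N M *ᵥ t)))
                - stair N R M *ᵥ (LapSinv (fine N M) ((N : ℕ) : ℂ) *ᵥ (LapSinv (fine N M) ((N : ℕ) : ℂ) *ᵥ (blkInj N M *ᵥ t))))) := by
  -- level N read through `Q′_{RN}J = Q′_N`, and `Q′*_{RN} = J Q′*_N`
  have hN : QsOp N M *ᵥ (LapSinv (fine N M) ((N : ℕ) : ℂ) *ᵥ (LapSinv (fine N M) ((N : ℕ) : ℂ) *ᵥ (blkInj N M *ᵥ t)))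
      = QsOp (R * N) M *ᵥ (stair N R M *ᵥ (LapSinv (fine N M) ((N : ℕ) : ℂ) *ᵥ (LapSinv (fine N M) ((N : ℕ) : ℂ) *ᵥ
          (blkInj N M *ᵥ t)))) := by
    rw [Matrix.mulVec_mulVec (LapSinv (fine N M) ((N : ℕ) : ℂ) *ᵥ _) (QsOp (R * N) M) (stair N R M), QsOp_mul_stair]
  rw [hN, ← stair_mulVec_blkInj N R M t, ← Matrix.mulVec_sub, LapSinv2_succ_sub_stair]

/-- the same with the massless defects written through `LapSinv_succ_sub_stair` (`D g = −Δ′⁻¹(Δ′(J Δ⁻¹g) − J(Δ Δ⁻¹g))`): the one-step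
difference of the block form of `Δ⁻²` is `Q′_{RN}Δ′⁻¹` applied to exact Laplacian staircase defects. [folklore] -/
theorem blockBiLapInv_succ_sub_eq (t : Tor M → ℂ) :
    QsOp (R * N) M *ᵥ (LapSinv (fine (R * N) M) ((R * N : ℕ) : ℂ) *ᵥ (LapSinv (fine (R * N) M) ((R * N : ℕ) : ℂ) *ᵥ
        (blkInj (R * N) M *ᵥ t)))
      - QsOp N M *ᵥ (LapSinv (fine N M) ((N : ℕ) : ℂ) *ᵥ (LapSinv (fine N M) ((N : ℕ) : ℂ) *ᵥ (blkInj N M *ᵥ t)))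
      = QsOp (R * N) M *ᵥ
          (LapSinv (fine (R * N) M) ((R * N : ℕ) : ℂ) *ᵥ
              (-(LapSinv (fine (R * N) M) ((R * N : ℕ) : ℂ) *ᵥ
                (LapS (fine (R * N) M) ((R * N : ℕ) : ℂ) *ᵥ (stair N R M *ᵥ (LapSinv (fine N M) ((N : ℕ) : ℂ) *ᵥ (blkInj N M *ᵥ t)))
                  - stair N R M *ᵥ (LapS (fine N M) ((N : ℕ) : ℂ) *ᵥ (LapSinv (fine N M) ((N : ℕ) : ℂ) *ᵥ (blkInj N M *ᵥ t))))))
            + -(LapSinv (fine (R * N) M) ((R * N : ℕ) : ℂ) *ᵥ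
                (LapS (fine (R * N) M) ((R * N : ℕ) : ℂ) *ᵥ (stair N R M *ᵥ (LapSinv (fine N M) ((N : ℕ) : ℂ) *ᵥ
                    (LapSinv (fine N M) ((N : ℕ) : ℂ) *ᵥ (blkInj N M *ᵥ t))))
                  - stair N R M *ᵥ (LapS (fine N M) ((N : ℕ) : ℂ) *ᵥ (LapSinv (fine N M) ((N : ℕ) : ℂ) *ᵥ
                    (LapSinv (fine N M) ((N : ℕ) : ℂ) *ᵥ (blkInj N M *ᵥ t))))))) := by
  rw [blockBiLapInv_succ_sub, LapSinv_succ_sub_stair, LapSinv_succ_sub_stair]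

end Summit.QuantumFields.BalabanUV.Beta.GAN24.BiharmonicBlockFormStaircase

end
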